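import Mathlib
import HarnessLib
import Summits.HubbardSuperconductivity.HubbardSuperconductivity.Theses.EnslavedA1g
import Summits.HubbardSuperconductivity.HubbardSuperconductivity.Theorems.EnslavedA1gLowerSandwich
import Summits.HubbardSuperconductivity.HubbardSuperconductivity.Theorems.EnslavedA1gUpperSandwichRemovalWindow
import Summits.HubbardSuperconductivity.HubbardSuperconductivity.Theorems.EnslavedA1gUpperSandwichLocalityTorus
import Summits.HubbardSuperconductivity.HubbardSuperconductivity.Theorems.NoGoNogoSingletPairKillsSaturatedFM
import Literature.MathematicalPhysics.QuantumLattice.PairingChannelIdentities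

/-!
# Route `EnslavedA1g`, support `EnslavedA1gUpperSandwich` (item `stmt-HubbardSuperconductivity-0938`)

UPPER SANDWICH. For every `U ≥ 0` there is `C = C(U)` such that for even `L ≥ 4`, `N + 2 ≤ L²` and
every normalised ground state `ψ` of `H = hubbardTorus 2 L 1 U` in the sector `(N, S^z = 0)`, with
`κ₊ := U - (E(N+2,0) - E(N,0))`, `x = ‖P_{s'} ψ‖²`, `y = ‖P_s ψ‖²`
(`P_{s'} = pairField extendedSWave L`, `P_s = pairField sWave L`):
`4 x² ≤ (C L² + κ₊ x)(C L² + κ₊ y)` (`enslavedA1gUpperSandwich_proof`).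

Proof (the route's sketch, all inputs proved in the tree):
1. `N` is even (`szSector N 0 = ⊥` for odd `N`); for `N = 0` both sides are trivial (`P ψ = 0`,
   `NoGo.pairField_mulVec_eq_zero_of_isNParticle_zero`).
2. For `N ≥ 2`: by the enslaved-A1g identity (`enslavedA1gIdentity_proof`, item 0936) and
   `Hψ = Eψ`, `2 P_{s'}ψ = K P_sψ` with `K = H - E + U`; `P_{s'}ψ, P_sψ ∈ szSector (N-2) 0`, on which
   `K ≥ 0` by Yang's bound `E ≤ E(N-2,0) + U` (`minEnergyOn_szSector_add_two_le` of the lower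
   sandwich file); Cauchy–Schwarz for the `K`-form on that sector gives `4x² ≤ ⟨u,Ku⟩⟨v,Kv⟩`.
3. For `A ∈ {P_{s'}, P_s}`: Koma–Tasaki's identity (`mc_dotProduct_doubleComm_of_eigen`)
   `⟨ψ,[Aᴴ,[H,A]]ψ⟩ = ⟨Aψ,(H-E)Aψ⟩ + ⟨Aᴴψ,(H-E)Aᴴψ⟩`, the variational bound
   `⟨Aᴴψ,(H-E)Aᴴψ⟩ ≥ (E(N+2,0)-E)‖Aᴴψ‖²` (`Aᴴψ ∈ szSector (N+2) 0`), the locality bounds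
   `|⟨[Aᴴ,[H,A]]⟩|, |⟨[A,Aᴴ]⟩| = O(L²)` (`exists_doubleCommutator_pairField_bound`,
   `exists_commutator_pairField_bound`) and the window `-8 ≤ E(N+2,0) - E ≤ U` (Yang;
   `minEnergyOn_szSector_le_add_two`) give `⟨Aψ, K Aψ⟩ ≤ C L² + κ₊ ‖Aψ‖²`.

Sources: T. Koma, H. Tasaki, J. Stat. Phys. 76 (1994) 745; C. N. Yang, PRL 63 (1989) 2144;
G.-S. Tian, J. Phys. A 27 (1994) 6677 (the inseparability of extended-`s` and on-site pairing
orders: nearest prior art); S.-C. Zhang, PRL 65 (1990) 120. Bookkeeping folklore.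
-/

noncomputable section

-- the mandated namespace `Summit.<Summit>.<Problem>.Theorems` repeats `HubbardSuperconductivity`
set_option linter.dupNamespace false

namespace Summit.HubbardSuperconductivity.HubbardSuperconductivity.Theorems.EnslavedA1g.UpperSandwich

open Matrix Finset
open Literature.Probability.LatticeModels Literature.MathematicalPhysics.QuantumLattice
open Summit.HubbardSuperconductivity.HubbardSuperconductivity.Theses.EnslavedA1g
open scoped ComplexOrder

/-! ### Linear algebra: Cauchy–Schwarz for a form that is positive on a subspace -/

section LinAlg

variable {n : Type} [Fintype n]

/-- **Cauchy–Schwarz on a subspace.** If the Hermitian form `⟨·, K ·⟩` is positive semidefinite on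
the subspace `S`, then `Re ⟨u, K v⟩ ≤ √⟨u, K u⟩ √⟨v, K v⟩` for `u, v ∈ S` (discriminant of
`t ↦ ⟨u - t v, K (u - t v)⟩ ≥ 0`). [folklore] -/
theorem re_form_le_sqrt_mul_sqrt_of_mem {K : Matrix n n ℂ} (hK : K.IsHermitian)
    (S : Submodule ℂ (n → ℂ)) (hpsd : ∀ φ ∈ S, 0 ≤ (star φ ⬝ᵥ K *ᵥ φ).re) {u v : n → ℂ}
    (hu : u ∈ S) (hv : v ∈ S) :
    (star u ⬝ᵥ K *ᵥ v).re ≤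
      Real.sqrt (star u ⬝ᵥ K *ᵥ u).re * Real.sqrt (star v ⬝ᵥ K *ᵥ v).re := by
  set a := (star u ⬝ᵥ K *ᵥ u).re with ha_def
  set b := (star v ⬝ᵥ K *ᵥ v).re with hb_def
  set c := (star u ⬝ᵥ K *ᵥ v).re with hc_def
  have ha : 0 ≤ a := hpsd u hu
  have hquad : ∀ t : ℝ, 0 ≤ b * (t * t) + -(2 * c) * t + a := fun t => by
    have h := hpsd (u - (t : ℂ) • v) (S.sub_mem hu (S.smul_mem _ hv))
    rwa [tian_re_form_sub_smul hK u v t] at h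
  have hdisc := discrim_le_zero hquad
  have hc2 : c ^ 2 ≤ a * b := by
    unfold discrim at hdisc
    nlinarith [hdisc]
  calc c ≤ |c| := le_abs_self c
    _ ≤ Real.sqrt (a * b) := Real.abs_le_sqrt hc2
    _ = Real.sqrt a * Real.sqrt b := Real.sqrt_mul ha b

/-- `Re ⟨ψ, (A Aᴴ - Aᴴ A) ψ⟩ = ‖Aᴴ ψ‖² - ‖A ψ‖²`. [folklore] -/
theorem re_star_dotProduct_commutator_mulVec (A : Matrix n n ℂ) (ψ : n → ℂ) :
    (star ψ ⬝ᵥ ((A * Aᴴ - Aᴴ * A) *ᵥ ψ)).re =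
      (star (Aᴴ *ᵥ ψ) ⬝ᵥ (Aᴴ *ᵥ ψ)).re - (star (A *ᵥ ψ) ⬝ᵥ (A *ᵥ ψ)).re := by
  rw [sub_mulVec, ← mulVec_mulVec, ← mulVec_mulVec, dotProduct_sub, Complex.sub_re,
    ThermodynamicLimit.star_mulVec_dotProduct Aᴴ, conjTranspose_conjTranspose,
    ThermodynamicLimit.star_mulVec_dotProduct A]

end LinAlg

/-! ### The real bookkeeping of step 3 -/

/-- The Koma–Tasaki bookkeeping as a real inequality: from the double-commutator identity
`(Ha - E na) + (Hb - E nb) = D`, the variational bound `Ep nb ≤ Hb`, the locality bounds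
`D ≤ d`, `|nb - na| ≤ c`, the window `-8 ≤ Ep - E ≤ U` and `d + (U + 8) c ≤ B`:
`Ha - (E - U) na ≤ B + (U - (Ep - E)) na`. [folklore] -/
theorem kt_bookkeeping {Ha Hb na nb E Ep U D d c B : ℝ} (hU : 0 ≤ U)
    (hKT : (Ha - E * na) + (Hb - E * nb) = D) (hvar : Ep * nb ≤ Hb) (hD : D ≤ d)
    (hc : |nb - na| ≤ c) (hw1 : Ep - E ≤ U) (hw2 : -8 ≤ Ep - E) (hB : d + (U + 8) * c ≤ B) :
    Ha - (E - U) * na ≤ B + (U - (Ep - E)) * na := by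
  have hc0 : 0 ≤ c := (abs_nonneg _).trans hc
  have hpq : -((Ep - E) * (nb - na)) ≤ (U + 8) * c := by
    have h1 : |Ep - E| ≤ U + 8 := abs_le.2 ⟨by linarith, by linarith⟩
    have h2 : |(Ep - E) * (nb - na)| ≤ (U + 8) * c := by
      rw [abs_mul]
      exact mul_le_mul h1 hc (abs_nonneg _) (by linarith)
    linarith [neg_abs_le ((Ep - E) * (nb - na))]
  have e1 : (Ep - E) * (nb - na) = Ep * nb - E * nb - Ep * na + E * na := by ring
  have e2 : (E - U) * na = E * na - U * na := by ring
  have e3 : (U - (Ep - E)) * na = U * na - Ep * na + E * na := by ring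
  rw [e2, e3]
  rw [e1] at hpq
  linarith

/-! ### The main theorem -/

section Main

open Summit.HubbardSuperconductivity.EnslavedA1g (enslavedA1gIdentity_proof re_two_smul_dotProduct)

/-- **Step 3 for one pair field.** For `A = pairField g L`, a normalised sector ground state `ψ`
(`Hψ = Eψ`, `ψ ∈ szSector (2(m+1)) 0`), the upper sector energy `Ep` with its variational bound and
window, and the locality constants `d, c` of `A`:
`Re ⟨Aψ, (H - (E - U)) Aψ⟩ ≤ (d + (U + 8) c) L² + (U - (Ep - E)) ‖Aψ‖²`. [folklore] -/
theorem re_form_pairField_le (g : Site 2 → ℝ) {L : ℕ} [NeZero L] {U : ℝ} (hU : 0 ≤ U) {m : ℕ}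
    {ψ : Fock (Orb (FermionTorus 2 L))} (hmem : ψ ∈ szSector (2 * (m + 1)) 0)
    (hHψ : hubbardTorus 2 L 1 U *ᵥ ψ =
      (((hubbardTorus 2 L 1 U).minEnergyOn (szSector (2 * (m + 1)) 0) : ℝ) : ℂ) • ψ)
    (hw1 : (hubbardTorus 2 L 1 U).minEnergyOn (szSector (2 * (m + 1) + 2) 0) -
      (hubbardTorus 2 L 1 U).minEnergyOn (szSector (2 * (m + 1)) 0) ≤ U)
    (hw2 : -8 ≤ (hubbardTorus 2 L 1 U).minEnergyOn (szSector (2 * (m + 1) + 2) 0) -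
      (hubbardTorus 2 L 1 U).minEnergyOn (szSector (2 * (m + 1)) 0))
    {d c : ℝ}
    (hd : |(star ψ ⬝ᵥ (((pairField g L)ᴴ *
          (hubbardTorus 2 L 1 U * pairField g L - pairField g L * hubbardTorus 2 L 1 U) -
        (hubbardTorus 2 L 1 U * pairField g L - pairField g L * hubbardTorus 2 L 1 U) *
          (pairField g L)ᴴ) *ᵥ ψ)).re| ≤ d * (L : ℝ) ^ 2)
    (hc : |(star ψ ⬝ᵥ ((pairField g L * (pairField g L)ᴴ - (pairField g L)ᴴ * pairField g L) *ᵥ ψ)).re|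
      ≤ c * (L : ℝ) ^ 2) :
    (star (pairField g L *ᵥ ψ) ⬝ᵥ ((hubbardTorus 2 L 1 U -
        (((hubbardTorus 2 L 1 U).minEnergyOn (szSector (2 * (m + 1)) 0) - U : ℝ) : ℂ) • 1) *ᵥ
          (pairField g L *ᵥ ψ))).re ≤
      (d + (U + 8) * c) * (L : ℝ) ^ 2 +
        (U - ((hubbardTorus 2 L 1 U).minEnergyOn (szSector (2 * (m + 1) + 2) 0) -
          (hubbardTorus 2 L 1 U).minEnergyOn (szSector (2 * (m + 1)) 0))) *
          (star (pairField g L *ᵥ ψ) ⬝ᵥ (pairField g L *ᵥ ψ)).re := by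
  set H := hubbardTorus 2 L 1 U with hH
  set E : ℝ := H.minEnergyOn (szSector (2 * (m + 1)) 0) with hE
  set Ep : ℝ := H.minEnergyOn (szSector (2 * (m + 1) + 2) 0) with hEp
  set A := pairField g L with hA
  set a := A *ᵥ ψ with ha
  set b := Aᴴ *ᵥ ψ with hb
  have hHerm : H.IsHermitian := LiebThm1.hamiltonian_isHermitian (fermionTorusGraph 2 L) 1 U
  -- the form of `K = H - (E - U)`
  have hform : (star a ⬝ᵥ ((H - ((E - U : ℝ) : ℂ) • 1) *ᵥ a)).re =
      (star a ⬝ᵥ (H *ᵥ a)).re - (E - U) * (star a ⬝ᵥ a).re := by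
    rw [sub_mulVec, smul_mulVec, one_mulVec, dotProduct_sub, dotProduct_smul, smul_eq_mul,
      Complex.sub_re, Complex.re_ofReal_mul]
  rw [hform]
  -- Koma–Tasaki's identity
  have hKT := congrArg Complex.re (WcbcsSsbToTorusLRO.mc_dotProduct_doubleComm_of_eigen hHerm hHψ A)
  rw [Complex.add_re, Complex.sub_re, Complex.sub_re, Complex.re_ofReal_mul,
    Complex.re_ofReal_mul] at hKT
  -- `Aᴴ ψ ∈ szSector (N + 2) 0` and the variational bound there
  have hbmem : b ∈ szSector (2 * (m + 1) + 2) 0 := by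
    have h := WcbcsSsbToTorusLRO.conjTranspose_pairFieldAt_mulVec_mem_szSector g
      (0 : TorusSite 2 L) hmem
    rwa [pairFieldAt_zero] at h
  have hvar : Ep * (star b ⬝ᵥ b).re ≤ (star b ⬝ᵥ (H *ᵥ b)).re :=
    minEnergyOn_mul_le_re hHerm _ hbmem
  -- the commutator expectation is `‖b‖² - ‖a‖²`
  have hcomm : (star ψ ⬝ᵥ ((A * Aᴴ - Aᴴ * A) *ᵥ ψ)).re =
      (star b ⬝ᵥ b).re - (star a ⬝ᵥ a).re := re_star_dotProduct_commutator_mulVec A ψ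
  rw [hcomm] at hc
  exact kt_bookkeeping hU hKT.symm hvar (le_of_abs_le hd) hc hw1 hw2 (le_of_eq (by ring))

/-- **`EnslavedA1gUpperSandwich` (route `EnslavedA1g`, item 0938).** For every `U ≥ 0` there is
`C = C(U)` such that for even `L > 2`, `N + 2 ≤ L²` and every normalised `(N, S^z = 0)`-sector
ground state `ψ` of `hubbardTorus 2 L 1 U`, with `κ₊ = U - (E(N+2,0) - E(N,0))`:
`4 ‖P_{s'}ψ‖⁴ ≤ (C L² + κ₊ ‖P_{s'}ψ‖²)(C L² + κ₊ ‖P_sψ‖²)`. Proof: `2 P_{s'}ψ = K P_sψ`,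
`K = H - E_N + U ≥ 0` on the sector `(N-2, 0)` (enslaved-A1g identity + Yang), Cauchy–Schwarz in
the `K`-form, and for `A ∈ {P_{s'}, P_s}` the Koma–Tasaki double-commutator identity with the
locality bounds and the pair chemical-potential window. Koma–Tasaki, J. Stat. Phys. 76 (1994) 745;
Yang, PRL 63 (1989) 2144; Tian, J. Phys. A 27 (1994) 6677. [folklore] -/
theorem enslavedA1gUpperSandwich_proof : EnslavedA1gUpperSandwich := by
  intro U hU
  -- the locality constants of the two pair fields
  obtain ⟨dP, hdP0, hdP⟩ := exists_doubleCommutator_pairField_bound extendedSWave U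
  obtain ⟨dQ, hdQ0, hdQ⟩ := exists_doubleCommutator_pairField_bound sWave U
  obtain ⟨cP, hcP0, hcP⟩ := exists_commutator_pairField_bound extendedSWave
  obtain ⟨cQ, hcQ0, hcQ⟩ := exists_commutator_pairField_bound sWave
  refine ⟨dP + dQ + (U + 8) * (cP + cQ), fun L _ hLeven hL N ψ hNL hψ1 hGS => ?_⟩
  dsimp only
  obtain ⟨hmem, hne, hHψ⟩ := hGS
  have hU8 : 0 ≤ U + 8 := by linarith
  have hCP : dP + (U + 8) * cP ≤ dP + dQ + (U + 8) * (cP + cQ) := by nlinarith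
  have hCQ : dQ + (U + 8) * cQ ≤ dP + dQ + (U + 8) * (cP + cQ) := by nlinarith
  have hC0 : 0 ≤ dP + dQ + (U + 8) * (cP + cQ) := by positivity
  -- `N` is even
  obtain ⟨n, rfl, -⟩ := WcbcsSlater.exists_eq_two_mul_of_mem_szSector_zero hmem hne
  rw [PosSemidefTrace.expect_conjTranspose_mul, PosSemidefTrace.expect_conjTranspose_mul]
  rcases Nat.eq_zero_or_eq_succ_pred n with hn0 | hn
  · -- `N = 0`: both pair fields kill `ψ`
    subst hn0
    have hψ0 : IsNParticle 0 ψ := by simpa using ((mem_szSector_iff _ _ _).1 hmem).1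
    rw [Summit.HubbardSuperconductivity.NoGo.pairField_mulVec_eq_zero_of_isNParticle_zero extendedSWave L hψ0,
      Summit.HubbardSuperconductivity.NoGo.pairField_mulVec_eq_zero_of_isNParticle_zero sWave L hψ0]
    simp only [star_zero, dotProduct_zero, Complex.zero_re, mul_zero, add_zero]
    nlinarith [mul_self_nonneg ((dP + dQ + (U + 8) * (cP + cQ)) * (L : ℝ) ^ 2)]
  -- `N = 2(m+1)`
  obtain ⟨m, rfl⟩ : ∃ m, n = m + 1 := ⟨n - 1, by omega⟩
  set H := hubbardTorus 2 L 1 U with hHdef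
  have hHerm : H.IsHermitian := LiebThm1.hamiltonian_isHermitian (fermionTorusGraph 2 L) 1 U
  set E : ℝ := H.minEnergyOn (szSector (2 * (m + 1)) 0) with hEdef
  set Em : ℝ := H.minEnergyOn (szSector (2 * m) 0) with hEmdef
  set Ep : ℝ := H.minEnergyOn (szSector (2 * (m + 1) + 2) 0) with hEpdef
  -- Yang's bounds and the removal window
  have hYangm : E ≤ Em + U :=
    Summit.HubbardSuperconductivity.EnslavedA1g.minEnergyOn_szSector_add_two_le hLeven U (m := m)
      (by omega)
  have hw1 : Ep - E ≤ U := by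
    have h := Summit.HubbardSuperconductivity.EnslavedA1g.minEnergyOn_szSector_add_two_le
      (L := L) hLeven U (m := m + 1) (by omega)
    rw [show 2 * (m + 1 + 1) = 2 * (m + 1) + 2 by ring] at h
    change Ep ≤ E + U at h
    linarith
  have hw2 : -8 ≤ Ep - E := by
    have h := minEnergyOn_szSector_le_add_two L 1 hU (n := m + 1) (by omega)
    rw [abs_one, mul_one] at h
    change E ≤ Ep + 8 at h
    linarith
  -- the vectors `u = P_{s'} ψ`, `v = P_s ψ` lie in the sector `(N - 2, 0)`
  set u := pairField extendedSWave L *ᵥ ψ with hudef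
  set v := pairField sWave L *ᵥ ψ with hvdef
  have h2m : 2 * (m + 1) - 2 = 2 * m := by omega
  have hsec : ∀ g : Site 2 → ℝ, pairField g L *ᵥ ψ ∈ szSector (2 * m) 0 := fun g => by
    have h := WcbcsSsbToTorusLRO.pairFieldAt_mulVec_mem_szSector g (0 : TorusSite 2 L)
      (by omega : 2 ≤ 2 * (m + 1)) hmem
    rwa [pairFieldAt_zero, h2m] at h
  -- the shifted Hamiltonian `K = H - (E - U)` is nonnegative on that sector
  set K : Matrix _ _ ℂ := H - ((E - U : ℝ) : ℂ) • 1 with hKdef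
  have hK : K.IsHermitian := hHerm.sub (isHermitian_one.smul (Complex.conj_ofReal _))
  have hKform : ∀ w, (star w ⬝ᵥ K *ᵥ w).re = (star w ⬝ᵥ (H *ᵥ w)).re - (E - U) * (star w ⬝ᵥ w).re :=
    fun w => by
      rw [hKdef, sub_mulVec, smul_mulVec, one_mulVec, dotProduct_sub, dotProduct_smul, smul_eq_mul,
        Complex.sub_re, Complex.re_ofReal_mul]
  have hpsd : ∀ w ∈ szSector (2 * m) (0 : ℝ), 0 ≤ (star w ⬝ᵥ K *ᵥ w).re := fun w hw => by
    rw [hKform]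
    have h1 := minEnergyOn_mul_le_re hHerm _ hw
    have h0 : 0 ≤ (star w ⬝ᵥ w).re := re_star_dotProduct_self_nonneg w
    change Em * (star w ⬝ᵥ w).re ≤ (star w ⬝ᵥ (H *ᵥ w)).re at h1
    nlinarith
  -- the enslaved-A1g identity applied to `ψ`: `2 u = K v`
  have h2u : (2 : ℂ) • u = K *ᵥ v := by
    have h : ((2 : ℂ) • pairField extendedSWave L) *ᵥ ψ =
        (H * pairField sWave L - pairField sWave L * H + (U : ℂ) • pairField sWave L) *ᵥ ψ := by
      rw [enslavedA1gIdentity_proof L hL U]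
    rw [smul_mulVec, add_mulVec, sub_mulVec, ← mulVec_mulVec, ← mulVec_mulVec, hHψ, mulVec_smul,
      smul_mulVec] at h
    rw [hudef, hvdef, h, hKdef, sub_mulVec, smul_mulVec, one_mulVec, Complex.ofReal_sub, sub_smul]
    abel
  -- Cauchy–Schwarz in the `K`-form: `4 x² ≤ ⟨u, K u⟩ ⟨v, K v⟩`
  set x : ℝ := (star u ⬝ᵥ u).re with hxdef
  set y : ℝ := (star v ⬝ᵥ v).re with hydef
  have hx0 : 0 ≤ x := re_star_dotProduct_self_nonneg u
  have h2x : 2 * x = (star u ⬝ᵥ K *ᵥ v).re := by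
    rw [hxdef, ← re_two_smul_dotProduct, h2u]
  have hKu0 : 0 ≤ (star u ⬝ᵥ K *ᵥ u).re := hpsd u (hsec extendedSWave)
  have hKv0 : 0 ≤ (star v ⬝ᵥ K *ᵥ v).re := hpsd v (hsec sWave)
  have hCS : (star u ⬝ᵥ K *ᵥ v).re ≤
      Real.sqrt (star u ⬝ᵥ K *ᵥ u).re * Real.sqrt (star v ⬝ᵥ K *ᵥ v).re :=
    re_form_le_sqrt_mul_sqrt_of_mem hK (szSector (2 * m) 0) hpsd (hsec extendedSWave) (hsec sWave)
  have h4 : 4 * x ^ 2 ≤ (star u ⬝ᵥ K *ᵥ u).re * (star v ⬝ᵥ K *ᵥ v).re := by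
    rw [← h2x] at hCS
    have h := pow_le_pow_left₀ (by linarith : 0 ≤ 2 * x) hCS 2
    rw [mul_pow, mul_pow, Real.sq_sqrt hKu0, Real.sq_sqrt hKv0] at h
    nlinarith [h]
  -- the two form bounds
  have hKu := re_form_pairField_le extendedSWave hU hmem hHψ hw1 hw2 (hdP L ψ hψ1) (hcP L ψ hψ1)
  have hKv := re_form_pairField_le sWave hU hmem hHψ hw1 hw2 (hdQ L ψ hψ1) (hcQ L ψ hψ1)
  have hL2 : 0 ≤ (L : ℝ) ^ 2 := by positivity
  have hKu' : (star u ⬝ᵥ K *ᵥ u).re ≤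
      (dP + dQ + (U + 8) * (cP + cQ)) * (L : ℝ) ^ 2 + (U - (Ep - E)) * x := by
    have := mul_le_mul_of_nonneg_right hCP hL2
    change (star u ⬝ᵥ K *ᵥ u).re ≤ (dP + (U + 8) * cP) * (L : ℝ) ^ 2 + (U - (Ep - E)) * x at hKu
    linarith
  have hKv' : (star v ⬝ᵥ K *ᵥ v).re ≤
      (dP + dQ + (U + 8) * (cP + cQ)) * (L : ℝ) ^ 2 + (U - (Ep - E)) * y := by
    have := mul_le_mul_of_nonneg_right hCQ hL2
    change (star v ⬝ᵥ K *ᵥ v).re ≤ (dQ + (U + 8) * cQ) * (L : ℝ) ^ 2 + (U - (Ep - E)) * y at hKv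
    linarith
  calc 4 * x ^ 2 ≤ (star u ⬝ᵥ K *ᵥ u).re * (star v ⬝ᵥ K *ᵥ v).re := h4
    _ ≤ ((dP + dQ + (U + 8) * (cP + cQ)) * (L : ℝ) ^ 2 + (U - (Ep - E)) * x) *
        ((dP + dQ + (U + 8) * (cP + cQ)) * (L : ℝ) ^ 2 + (U - (Ep - E)) * y) :=
      mul_le_mul hKu' hKv' hKv0 (hKu0.trans hKu')

end Main

end Summit.HubbardSuperconductivity.HubbardSuperconductivity.Theorems.EnslavedA1g.UpperSandwich
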